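import Summits.FinalStateConjecture.FinalStateConjecture.Theorems.EIHFluxBalanceModulatedKerrHandoffOneHoleFarBound
import Summits.FinalStateConjecture.FinalStateConjecture.Theorems.EIHFluxBalanceModulatedKerrHandoffOneHoleTameBound
import Summits.FinalStateConjecture.FinalStateConjecture.Theorems.EIHFluxBalanceModulatedKerrHandoffOneHoleLimits
import Summits.FinalStateConjecture.FinalStateConjecture.Theorems.EIHFluxBalanceInertialRecessionAnsatzSmooth

/-!
# Route EIHFluxBalance — `ModulatedKerrHandoff`: stub `stub_oneHoleMatching` (one-hole profile matching)

Crux `stmt-FinalStateConjecture-10167`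
(`Summit.FinalStateConjecture.FinalStateConjecture.Theses.EIHFluxBalance.ModulatedKerrHandoff`), line
`photon-rocket-modulation`, registered stub `stub_oneHoleMatching` (S3a of the lead skeleton
`Lines/photon_rocket_modulation.lean`): the calculus core of the cone matching. For ONE hole with
sub-extremal limit parameters `(M, a)`, core radius `r₋ < rin < r₊`, smooth ALIGNED boosts of Lorentz
factor `≤ γ`, world-line of speed `≤ v < 1` eventually inside the cone `κ²t`, globally bounded and
eventually TAME moduli, mass drifting at the monopole rate `u^{-(3/4+σ)}`, and a smooth retarded clock:
(O1) the instantaneous summand is `C^∞` off the core; (O2) the retarded summand is eventually `C^∞` off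
the core; (O3) `sup_{x⁰ = t, ρ > rin} ‖D^{≤3}(ret − inst)‖ → 0`; (O4) the same with the weight
`1 + ‖x̲ − ξ(t)‖^{7/4}` on the cone `|x̲| ≤ κt`.

Proof (files `…OneHole*`): both summands are `ε • 𝔉 ∘ p` for ONE smooth kernel `𝔉` on
`ℝ × (E4 →L E4) × ℝ × E3` (mass-linearity, homogeneity, stationarity, Lorentz covariance of the
Kerr–Schild ansatz; `…OneHoleKernel`). FAR from the hole (`d ≥ (1 − v)t/2`) each summand is `O(1/d)`
in `C³` by Faà di Bruno with the parameter point in a compact box (`…OneHoleFarBound`). In the TAME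
regime (`U x ≥ (1 − κ)t/2`, `d ≤ 2t`) the difference is `ε K λ(x)` with
`λ(x) ≲ 1/t + 1/(ct)^{3/4+σ}` by the difference lemma of `…OneHoleDifference` (telescoping Faà di
Bruno, mean value along the parameter segment), fed by the clock calculus (`…OneHoleClock*`: `DU` by
first-order implicit differentiation, `D^{≤3}U` by bootstrap), the moduli (`…OneHoleModuli`: `Λ⁻¹` is
linear in `Λ` on `O(1,3)`; alignment kills the centre velocity in the rest frame) and tameness
(`…OneHoleTame*`). On the cone every late point is tame and `(1 + d^{7/4}) ε ≤ 2 + (2t)^{3/4}` is beaten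
by the rates (`…OneHoleLimits`); on the whole slab far points are `O(1/t)` and near points are tame.
Kerr–Schild 1965 §2–3; Kinnersley, Phys. Rev. 186 (1969) 1335, §2 (retarded time of an accelerated
source).
-/

noncomputable section

-- `Summit.<S>.<S>.…` (single-problem summit, D-0017) trips core's duplicate-namespace linter.
set_option linter.dupNamespace false

open scoped Manifold ContDiff Topology ENNReal
open Filter Set TopologicalSpace Literature.Geometry.Lorentzian
open Summit.FinalStateConjecture.FinalStateConjecture.Theorems

namespace Summit.FinalStateConjecture.FinalStateConjecture.Cruxes.ModulatedKerrHandoff.PhotonRocketModulation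

/-- A pointwise real bound on a slab gives the `ℝ≥0∞` `iSup` bound. [folklore] -/
theorem iSup₂_enorm_le_ofReal {S : Set E4} {F : E4 → E4 →L[ℝ] E4 →L[ℝ] ℝ} {g : ℝ}
    (h : ∀ x ∈ S, ∀ m ≤ 3, ‖iteratedFDeriv ℝ m F x‖ ≤ g) :
    (⨆ x ∈ S, ⨆ (m : ℕ) (_ : m ≤ 3), ‖iteratedFDeriv ℝ m F x‖ₑ) ≤ ENNReal.ofReal g :=
  iSup₂_le fun x hx ↦ iSup₂_le fun m hm ↦ enorm_le_ofReal_of_norm_le (h x hx m hm)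

/-- The weighted version. [folklore] -/
theorem iSup₂_weight_enorm_le_ofReal {S : Set E4} {F : E4 → E4 →L[ℝ] E4 →L[ℝ] ℝ} {w : E4 → ℝ}
    {g : ℝ} (hw : ∀ x, 0 ≤ w x) (h : ∀ x ∈ S, ∀ m ≤ 3, w x * ‖iteratedFDeriv ℝ m F x‖ ≤ g) :
    (⨆ x ∈ S, ⨆ (m : ℕ) (_ : m ≤ 3), ENNReal.ofReal (w x) * ‖iteratedFDeriv ℝ m F x‖ₑ) ≤
      ENNReal.ofReal g :=
  iSup₂_le fun x hx ↦ iSup₂_le fun m hm ↦ by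
    rw [← ofReal_norm, ← ENNReal.ofReal_mul (hw x)]
    exact ENNReal.ofReal_le_ofReal (h x hx m hm)

/-- Squeezing an `ℝ≥0∞`-valued function under `ofReal` of a real function tending to `0`. [folklore] -/
theorem tendsto_zero_of_le_ofReal {f : ℝ → ℝ≥0∞} {g : ℝ → ℝ} (hg : Tendsto g atTop (𝓝 0))
    (h : ∀ᶠ t in atTop, f t ≤ ENNReal.ofReal (g t)) : Tendsto f atTop (𝓝 0) := by
  refine tendsto_of_tendsto_of_tendsto_of_le_of_le' tendsto_const_nhds ?_
    (Eventually.of_forall fun _ ↦ zero_le) h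
  simpa using ENNReal.tendsto_ofReal hg

/-- **S3a · ONE-HOLE PROFILE MATCHING** (registered stub `stub_oneHoleMatching` of the crux item
`stmt-FinalStateConjecture-10167`, line `photon-rocket-modulation`): see the module docstring for the
statement (O1)–(O4) and the proof. Kerr–Schild 1965, §2–3; Kinnersley 1969, §2. [cite: KerrSchild1965, §3] -/
theorem stub_oneHoleMatching :
    ∀ (M a rin : ℝ) (Mf : ℝ → ℝ) (Λ : ℝ → lorentzGroup) (ξ : ℝ → E3) (Uc ρ : E4 → ℝ) (v A σ γ κ τ₀ : ℝ),
        (Kerr.IsSubextremal M a ∧ Kerr.rMinus M a < rin ∧ rin < Kerr.rPlus M a) →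
        (ContDiff ℝ ((⊤ : ℕ∞) : WithTop ℕ∞) ξ ∧ ContDiff ℝ ((⊤ : ℕ∞) : WithTop ℕ∞) (fun t ↦ ((Λ t : E4 ≃L[ℝ] E4) : E4 →L[ℝ] E4)) ∧ ContDiff ℝ ((⊤ : ℕ∞) : WithTop ℕ∞) Mf) →
        (0 ≤ v ∧ v < 1 ∧ ∀ u, ‖deriv ξ u‖ ≤ v) →
        (∀ u, (Λ u : E4 ≃L[ℝ] E4) (E4.basisVector 0) = ((Λ u : E4 ≃L[ℝ] E4) (E4.basisVector 0)) 0 • E4.ofTimeSpace 1 (deriv ξ u) ∧ 1 ≤ ((Λ u : E4 ≃L[ℝ] E4) (E4.basisVector 0)) 0 ∧ ((Λ u : E4 ≃L[ℝ] E4) (E4.basisVector 0)) 0 ≤ γ) →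
        (∀ u, (∀ k, 1 ≤ k → k ≤ 5 → ‖iteratedDeriv k ξ u‖ ≤ A) ∧ ∀ k ≤ 4, ‖iteratedDeriv k (fun t ↦ ((Λ t : E4 ≃L[ℝ] E4) : E4 →L[ℝ] E4)) u‖ ≤ A ∧ |iteratedDeriv k Mf u| ≤ A) →
        (0 < τ₀ ∧ 0 < σ ∧ ∀ u, τ₀ ≤ u → (∀ k, 2 ≤ k → k ≤ 5 → u ^ 2 * ‖iteratedDeriv k ξ u‖ ≤ A) ∧ (∀ k, 1 ≤ k → k ≤ 4 → u ^ 2 * ‖iteratedDeriv k (fun t ↦ ((Λ t : E4 ≃L[ℝ] E4) : E4 →L[ℝ] E4)) u‖ ≤ A) ∧ ∀ k ≤ 4, u ^ ((3 : ℝ) / 4 + σ) * |iteratedDeriv k (fun s ↦ Mf s - M) u| ≤ A) →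
        (0 < κ ∧ κ < 1 ∧ ∀ᶠ t in atTop, ‖ξ t‖ ≤ κ ^ 2 * t) →
        (∀ x, x 0 - Uc x = ‖E4.spatial x - ξ (Uc x)‖) →
        ContDiffOn ℝ ((⊤ : ℕ∞) : WithTop ℕ∞) Uc {x : E4 | E4.spatial x ≠ ξ (Uc x)} →
        (∀ x, ρ x = Kerr.radius a (poincareInv (Λ (x 0)) (E4.ofTimeSpace (x 0) (ξ (x 0))) x)) →
          (∀ x : E4, rin < ρ x → ContDiffAt ℝ ((⊤ : ℕ∞) : WithTop ℕ∞) (fun y ↦ boostedKerrBilin (Λ (y 0)) (E4.ofTimeSpace (y 0) (ξ (y 0))) M a y - Minkowski.bilin) x) ∧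
          (∃ T : ℝ, ∀ x : E4, T < x 0 → rin < ρ x → ContDiffAt ℝ ((⊤ : ℕ∞) : WithTop ℕ∞) (fun y ↦ boostedKerrBilin (Λ (Uc y)) (E4.ofTimeSpace (Uc y) (ξ (Uc y))) (Mf (Uc y)) a y - Minkowski.bilin) x) ∧
          Tendsto (fun t : ℝ ↦ ⨆ x ∈ {x : E4 | x 0 = t ∧ τ₀ < x 0 ∧ rin < ρ x}, ⨆ (m : ℕ) (_ : m ≤ 3), ‖iteratedFDeriv ℝ m (fun y ↦ boostedKerrBilin (Λ (Uc y)) (E4.ofTimeSpace (Uc y) (ξ (Uc y))) (Mf (Uc y)) a y - boostedKerrBilin (Λ (y 0)) (E4.ofTimeSpace (y 0) (ξ (y 0))) M a y) x‖ₑ) atTop (𝓝 0) ∧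
          Tendsto (fun t : ℝ ↦ ⨆ x ∈ {x : E4 | x 0 = t ∧ E4.spatialNorm x ≤ κ * t ∧ τ₀ < x 0 ∧ rin < ρ x}, ⨆ (m : ℕ) (_ : m ≤ 3), ENNReal.ofReal (1 + √(√(‖E4.spatial x - ξ t‖ ^ 7))) * ‖iteratedFDeriv ℝ m (fun y ↦ boostedKerrBilin (Λ (Uc y)) (E4.ofTimeSpace (Uc y) (ξ (Uc y))) (Mf (Uc y)) a y - boostedKerrBilin (Λ (y 0)) (E4.ofTimeSpace (y 0) (ξ (y 0))) M a y) x‖ₑ) atTop (𝓝 0) := by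
  intro M a rin Mf Λ ξ Uc ρ v A σ γ κ τ₀ hsub hsm hvel hal hgl htame hcone hclock hU hρ
  -- constants and the two regime bounds
  have hrin : 0 < rin := OneHole.rin_pos hsub
  have h1v : 0 < 1 - v := by linarith only [hvel.2.1]
  have hκ : 0 < (1 - κ) / 2 := by linarith only [hcone.2.1]
  have hσ : 0 < σ := htame.2.1
  obtain ⟨Kf, Tf, hKf0, hTf0, hfar⟩ := OneHole.far_pointwise hsub hsm hvel hal hgl hcone hclock hU
  obtain ⟨Kt, Tt, hKt0, hTt0, htm⟩ := OneHole.tame_pointwise hsub hsm hvel hal hgl htame hcone hclock hU hρ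
  obtain ⟨Tc, hTc0, hconeU⟩ := OneHole.exists_forall_cone_clock_ge hsm.1 hvel.1 hvel.2.1 hvel.2.2 hclock
    hcone.1 hcone.2.1 hcone.2.2
  obtain ⟨T₁, hT₁⟩ := eventually_atTop.mp hcone.2.2
  -- smoothness of the two summands where the radii are positive
  have hO1 : ∀ x : E4, rin < ρ x → ContDiffAt ℝ ∞
      (fun y ↦ boostedKerrBilin (Λ (y 0)) (E4.ofTimeSpace (y 0) (ξ (y 0))) M a y - Minkowski.bilin) x :=
    fun x hx ↦ (contDiffAt_boostedKerrBilin_modulated M a hsm.2.1 hsm.1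
      (by rw [← hρ x]; exact hrin.trans hx)).sub contDiffAt_const
  -- at late points off the core: the retarded radius is positive (far or tame)
  have hret : ∀ x : E4, max Tf Tt ≤ x 0 → rin < ρ x →
      0 < Kerr.radius a ((Λ (Uc x) : E4 ≃L[ℝ] E4).symm (x - E4.ofTimeSpace (Uc x) (ξ (Uc x)))) ∧
      ((1 - v) / 2 * x 0 ≤ ‖E4.spatial x - ξ (x 0)‖ ∨
        ((1 - κ) / 2 * x 0 ≤ Uc x ∧ ‖E4.spatial x - ξ (x 0)‖ ≤ 2 * x 0)) := by
    intro x hx hρx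
    have ht0 : 0 < x 0 := hTf0.trans_le ((le_max_left _ _).trans hx)
    rcases le_or_gt ((1 - v) / 2 * x 0) ‖E4.spatial x - ξ (x 0)‖ with hfar' | hnear
    · exact ⟨(hfar x ((le_max_left _ _).trans hx) hfar').1, Or.inl hfar'⟩
    · have hU2 : x 0 / 2 ≤ Uc x := OneHole.clock_ge_half hsm.1 hvel.1 hvel.2.1 hvel.2.2 hclock
        (by rw [mul_comm, ← mul_div_assoc] at hnear; linarith only [hnear])
      have hUc : (1 - κ) / 2 * x 0 ≤ Uc x := by nlinarith only [hU2, hcone.1, ht0]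
      have hd2 : ‖E4.spatial x - ξ (x 0)‖ ≤ 2 * x 0 := by nlinarith only [hnear, hvel.1, ht0]
      exact ⟨(htm x ((le_max_right _ _).trans hx) hUc hd2 hρx).1, Or.inr ⟨hUc, hd2⟩⟩
  have hretC : ∀ x : E4, max Tf Tt ≤ x 0 → rin < ρ x → ContDiffAt ℝ ∞
      (fun y ↦ boostedKerrBilin (Λ (Uc y)) (E4.ofTimeSpace (Uc y) (ξ (Uc y))) (Mf (Uc y)) a y -
        Minkowski.bilin) x := fun x hx hρx ↦ by
    have hΔ := OneHole.retardation_lower hsm.1 hvel hal hclock hρ hρx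
    have hΔ0 : x 0 - Uc x ≠ 0 := by
      intro h0; rw [h0, mul_zero] at hΔ; exact (lt_irrefl _ (hrin.trans hΔ))
    exact OneHole.contDiffAt_ret_of_radius_pos hsm hvel hclock hU hΔ0 (hret x hx hρx).1
  refine ⟨hO1, ⟨max Tf Tt, fun x hx hρx ↦ hretC x hx.le hρx⟩, ?_, ?_⟩
  · -- (O3): the whole slab
    have hg := ((tendsto_const_nhds (x := 4 * Kf / (1 - v))).div_atTop tendsto_id).add
      ((OneHole.tendsto_rate hκ hσ).const_mul Kt)
    rw [zero_add, mul_zero] at hg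
    refine tendsto_zero_of_le_ofReal hg ?_
    filter_upwards [eventually_ge_atTop (max Tf Tt), eventually_ge_atTop 1] with t ht ht1
    refine iSup₂_enorm_le_ofReal fun x hx m hm ↦ ?_
    obtain ⟨hxt, -, hρx⟩ := hx
    have hxT : max Tf Tt ≤ x 0 := by rw [hxt]; exact ht
    have ht0 : 0 < x 0 := by rw [hxt]; linarith only [ht1]
    have hrate0 : 0 ≤ 1 / x 0 + 1 / ((1 - κ) / 2 * x 0) ^ ((3 : ℝ) / 4 + σ) := by positivity
    rcases (hret x hxT hρx).2 with hfar' | ⟨hUc, hd2⟩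
    · -- far: both summands are `O(1/d)`
      obtain ⟨h1, h0⟩ := (hfar x ((le_max_left _ _).trans hxT) hfar').2 m hm
      have hd0 : 0 < ‖E4.spatial x - ξ (x 0)‖ := lt_of_lt_of_le (by positivity) hfar'
      have hsub' : (fun y ↦ boostedKerrBilin (Λ (Uc y)) (E4.ofTimeSpace (Uc y) (ξ (Uc y))) (Mf (Uc y)) a y
          - boostedKerrBilin (Λ (y 0)) (E4.ofTimeSpace (y 0) (ξ (y 0))) M a y) =
          (fun y ↦ boostedKerrBilin (Λ (Uc y)) (E4.ofTimeSpace (Uc y) (ξ (Uc y))) (Mf (Uc y)) a y -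
            Minkowski.bilin) -
          fun y ↦ boostedKerrBilin (Λ (y 0)) (E4.ofTimeSpace (y 0) (ξ (y 0))) M a y - Minkowski.bilin := by
        funext y; simp only [Pi.sub_apply]; abel
      rw [hsub', iteratedFDeriv_sub_apply ((hretC x hxT hρx).of_le (WithTop.coe_le_coe.mpr le_top))
        ((hO1 x hρx).of_le (WithTop.coe_le_coe.mpr le_top))]
      refine (norm_sub_le _ _).trans ?_
      have hKd : Kf / ‖E4.spatial x - ξ (x 0)‖ ≤ 2 * Kf / ((1 - v) * x 0) := by
        rw [div_le_div_iff₀ hd0 (by positivity)]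
        nlinarith only [hfar', hKf0, ht0.le]
      have hKt' : 0 ≤ Kt * (1 / t + 1 / ((1 - κ) / 2 * t) ^ ((3 : ℝ) / 4 + σ)) := by
        rw [← hxt]; positivity
      calc _ ≤ 2 * Kf / ((1 - v) * x 0) + 2 * Kf / ((1 - v) * x 0) := add_le_add (h1.trans hKd) (h0.trans hKd)
        _ = 4 * Kf / (1 - v) / t := by rw [hxt]; field_simp; ring
        _ ≤ _ := by rw [id]; linarith only [hKt']
    · -- tame
      have h := (htm x ((le_max_right _ _).trans hxT) hUc hd2 hρx).2 m hm
      refine h.trans ?_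
      have hε1 : (max 1 ‖E4.spatial x - ξ (x 0)‖)⁻¹ ≤ 1 := inv_le_one_of_one_le₀ (le_max_left _ _)
      have hK1 : Kt * (max 1 ‖E4.spatial x - ξ (x 0)‖)⁻¹ ≤ Kt := mul_le_of_le_one_right hKt0 hε1
      have hf0 : 0 ≤ 4 * Kf / (1 - v) / t := by rw [← hxt]; positivity
      rw [hxt] at hrate0 ⊢
      calc Kt * (max 1 ‖E4.spatial x - ξ t‖)⁻¹ * (1 / t + 1 / ((1 - κ) / 2 * t) ^ ((3 : ℝ) / 4 + σ))
          ≤ Kt * (1 / t + 1 / ((1 - κ) / 2 * t) ^ ((3 : ℝ) / 4 + σ)) := by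
            rw [hxt] at hK1; exact mul_le_mul_of_nonneg_right hK1 hrate0
        _ ≤ _ := by rw [id]; linarith only [hf0]
  · -- (O4): the weighted cone
    have hg := (OneHole.tendsto_weight_mul_rate hκ hσ).const_mul Kt
    rw [mul_zero] at hg
    refine tendsto_zero_of_le_ofReal hg ?_
    filter_upwards [eventually_ge_atTop (max Tf Tt), eventually_ge_atTop (max Tc (max T₁ 0))] with t ht ht'
    refine iSup₂_weight_enorm_le_ofReal (fun x ↦ by positivity) fun x hx m hm ↦ ?_
    obtain ⟨hxt, hxκ, -, hρx⟩ := hx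
    have hxT : max Tf Tt ≤ x 0 := by rw [hxt]; exact ht
    have ht0 : 0 ≤ x 0 := by rw [hxt]; exact (le_max_right _ _).trans ((le_max_right _ _).trans ht')
    have hUc : (1 - κ) / 2 * x 0 ≤ Uc x := by
      have h := hconeU x (by rw [hxt]; exact (le_max_left _ _).trans ht') (by rw [hxt]; exact hxκ)
      linarith only [h, show (1 - κ) / 2 * x 0 = (1 - κ) * x 0 / 2 by ring]
    have hξt : ‖ξ (x 0)‖ ≤ κ ^ 2 * x 0 :=
      hT₁ _ (by rw [hxt]; exact (le_max_left _ _).trans ((le_max_right _ _).trans ht'))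
    have hd2 : ‖E4.spatial x - ξ (x 0)‖ ≤ 2 * x 0 :=
      OneHole.dist_le_two_mul_of_cone hcone.1 hcone.2.1 (by rw [hxt]; exact hxκ) hξt ht0
    have h := (htm x ((le_max_right _ _).trans hxT) hUc hd2 hρx).2 m hm
    have hw := OneHole.weight_mul_scale_le (norm_nonneg (E4.spatial x - ξ (x 0))) hd2
    have hrate0 : 0 ≤ 1 / x 0 + 1 / ((1 - κ) / 2 * x 0) ^ ((3 : ℝ) / 4 + σ) := by positivity
    have hw0 : 0 ≤ 1 + √(√(‖E4.spatial x - ξ (x 0)‖ ^ 7)) := by positivity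
    set N : ℝ := ‖iteratedFDeriv ℝ m (fun y ↦
      boostedKerrBilin (Λ (Uc y)) (E4.ofTimeSpace (Uc y) (ξ (Uc y))) (Mf (Uc y)) a y -
      boostedKerrBilin (Λ (y 0)) (E4.ofTimeSpace (y 0) (ξ (y 0))) M a y) x‖ with hN
    have hN0 : 0 ≤ N := norm_nonneg _
    rw [← hxt]
    calc (1 + √(√(‖E4.spatial x - ξ (x 0)‖ ^ 7))) * N
        ≤ (1 + √(√(‖E4.spatial x - ξ (x 0)‖ ^ 7))) * (Kt * (max 1 ‖E4.spatial x - ξ (x 0)‖)⁻¹ *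
            (1 / x 0 + 1 / ((1 - κ) / 2 * x 0) ^ ((3 : ℝ) / 4 + σ))) := mul_le_mul_of_nonneg_left h hw0
      _ = Kt * (((1 + √(√(‖E4.spatial x - ξ (x 0)‖ ^ 7))) * (max 1 ‖E4.spatial x - ξ (x 0)‖)⁻¹) *
            (1 / x 0 + 1 / ((1 - κ) / 2 * x 0) ^ ((3 : ℝ) / 4 + σ))) := by ring
      _ ≤ Kt * ((2 + √(√((2 * x 0) ^ 3))) * (1 / x 0 + 1 / ((1 - κ) / 2 * x 0) ^ ((3 : ℝ) / 4 + σ))) :=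
          mul_le_mul_of_nonneg_left (mul_le_mul_of_nonneg_right hw hrate0) hKt0

end Summit.FinalStateConjecture.FinalStateConjecture.Cruxes.ModulatedKerrHandoff.PhotonRocketModulation

end
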